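import Mathlib
import Summits.Ventures.HodgeRepro2.T5ConjugationRestriction
import Summits.Ventures.HodgeRepro2.T5CMConjugation
import Summits.Ventures.HodgeRepro2.T5FrobeniusGenerates

/-!
# T5CMDecomposition — «c ∈ D_P ⟺ w non-split in E» with `c` Mathlib's complex conjugation
(Tier-5 sub-step N2, row N2.2.5 support)

`T5ConjugationDecomposition` (file 65) and `T5ConjugationRestriction` (file 71) proved row N2.2.5's first
link — for a prime `P` of `𝓞_E` above `w = P ∩ 𝓞_F`, `c • P = P` iff `w` is non-split in `E` — for an
ABSTRACT `σ ≠ 1` of a quadratic Galois `E/F`, resp. an abstract involution `c` of a cyclic `Gal(E/ℚ)`;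
`T5DecompositionOrder` (file 66) read `c ∈ D_P` as `2 ∣ |D_P| = e·f`.  On Mathlib's CM field `K`
(`NumberField.IsCMField K`, `K⁺ = maximalRealSubfield K`, `c = complexConj K`) all of this is now
stated for the complex conjugation itself:

* `complexConj_smul_eq_iff` / `complexConj_mem_stabilizer_iff`: `c • P = P ⟺ (P ∩ 𝓞_{K⁺})` has exactly
  one prime above it in `𝓞_K` (`c ∈ Gal(K/K⁺)`; file 65 with `σ = complexConj K`);
* for `K/ℚ` Galois, p7's `conjGal K = (complexConj K).restrictScalars ℚ` acts on `𝓞_K` and its ideals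
  exactly as `complexConj K` does (`conjGal_smul_coe`, `conjGal_smul_ideal`), so the same criterion
  holds in `Gal(K/ℚ)` (`conjGal_smul_eq_iff`, `conjGal_mem_stabilizer_iff`);
* for cyclic `Gal(K/ℚ)`: `c ∈ D_P ⟺ 2 ∣ |D_P|` (`conjGal_mem_stabilizer_iff_two_dvd_card`, file 66 with
  `orderOf c = 2` from `T5CMConjugation`), hence `2 ∣ e(P∣p)·f(P∣p) ⟺ w non-split`
  (`two_dvd_ramificationIdx_mul_inertiaDeg_iff`) — row N2.2.5's chain «c ∈ D_p iff Frob_p has even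
  order iff w non-split» with the decomposition group read as `D_P = Stab(P)` and `|D_P| = e·f`.

Prose (unchanged): that the brief's `E` IS a Mathlib CM field (the instantiation); the word «Frobenius».
-/

namespace Summit.Ventures.HodgeRepro2.T5CMDecomposition

open Summit.Ventures.HodgeRepro2 NumberField NumberField.IsCMField
open scoped Pointwise

variable (K : Type*) [Field K] [NumberField K] [IsCMField K]

section Relative

/-- **Row N2.2.5's first link on a CM field**: the complex conjugation fixes the prime `P` of `𝓞_K`
iff the prime `P ∩ 𝓞_{K⁺}` of `K⁺` has exactly one prime of `𝓞_K` above it (is non-split in `K`). -/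
theorem complexConj_smul_eq_iff (P : Ideal (𝓞 K)) [P.IsPrime] :
    complexConj K • P = P ↔
      ((P.under (𝓞 (maximalRealSubfield K))).primesOver (𝓞 K)).ncard = 1 :=
  T5ConjugationDecomposition.smul_eq_iff_ncard_primesOver_eq_one
    (Algebra.IsQuadraticExtension.finrank_eq_two (maximalRealSubfield K) K) (complexConj_ne_one K) P

/-- `c ∈ D_P` (the stabiliser of `P` in `Gal(K/K⁺)`) iff `P ∩ 𝓞_{K⁺}` is non-split in `K`. -/
theorem complexConj_mem_stabilizer_iff (P : Ideal (𝓞 K)) [P.IsPrime] :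
    complexConj K ∈ MulAction.stabilizer (K ≃ₐ[maximalRealSubfield K] K) P ↔
      ((P.under (𝓞 (maximalRealSubfield K))).primesOver (𝓞 K)).ncard = 1 := by
  rw [MulAction.mem_stabilizer_iff]
  exact complexConj_smul_eq_iff K P

end Relative

section Absolute

open T5CMTypeGaloisDialect

variable [IsGalois ℚ K]

/-- `conjGal K` acts on `𝓞_K` as the complex conjugation. -/
theorem conjGal_smul_coe (x : 𝓞 K) : ((conjGal K • x : 𝓞 K) : K) = complexConj K x := rfl

/-- `complexConj K` acts on `𝓞_K` as itself. -/
theorem complexConj_smul_coe (x : 𝓞 K) : ((complexConj K • x : 𝓞 K) : K) = complexConj K x := rfl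

/-- The two actions on `𝓞_K` agree elementwise. -/
theorem conjGal_smul_eq_complexConj_smul (x : 𝓞 K) : conjGal K • x = complexConj K • x :=
  RingOfIntegers.ext (by rw [conjGal_smul_coe, complexConj_smul_coe])

/-- The two actions on the ideals of `𝓞_K` agree. -/
theorem conjGal_smul_ideal (P : Ideal (𝓞 K)) : conjGal K • P = complexConj K • P := by
  have hinv : (complexConj K)⁻¹ = complexConj K :=
    inv_eq_of_mul_eq_one_right (by ext z; simp)
  ext x
  rw [Ideal.mem_pointwise_smul_iff_inv_smul_mem, Ideal.mem_pointwise_smul_iff_inv_smul_mem,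
    conjGal_inv, hinv, conjGal_smul_eq_complexConj_smul]

/-- **Row N2.2.5's first link in `Gal(K/ℚ)`**: `conjGal K • P = P ⟺ P ∩ 𝓞_{K⁺}` non-split in `K`. -/
theorem conjGal_smul_eq_iff (P : Ideal (𝓞 K)) [P.IsPrime] :
    conjGal K • P = P ↔ ((P.under (𝓞 (maximalRealSubfield K))).primesOver (𝓞 K)).ncard = 1 := by
  rw [conjGal_smul_ideal]
  exact complexConj_smul_eq_iff K P

/-- `c ∈ D_P ⊆ Gal(K/ℚ)` iff `P ∩ 𝓞_{K⁺}` is non-split in `K`. -/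
theorem conjGal_mem_stabilizer_iff (P : Ideal (𝓞 K)) [P.IsPrime] :
    conjGal K ∈ MulAction.stabilizer (K ≃ₐ[ℚ] K) P ↔
      ((P.under (𝓞 (maximalRealSubfield K))).primesOver (𝓞 K)).ncard = 1 := by
  rw [MulAction.mem_stabilizer_iff]
  exact conjGal_smul_eq_iff K P

variable [IsCyclic (K ≃ₐ[ℚ] K)]

/-- In a cyclic `Gal(K/ℚ)`: `c ∈ D_P ⟺ 2 ∣ |D_P|` (file 66's parity lemma for the complex conjugation). -/
theorem conjGal_mem_stabilizer_iff_two_dvd_card (P : Ideal (𝓞 K)) :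
    conjGal K ∈ MulAction.stabilizer (K ≃ₐ[ℚ] K) P ↔
      2 ∣ Nat.card (MulAction.stabilizer (K ≃ₐ[ℚ] K) P) :=
  T5DecompositionOrder.mem_iff_two_dvd_card (T5CMConjugation.orderOf_conjGal K) _

/-- **Row N2.2.5's chain on a CM field**: `2 ∣ |D_P| ⟺ P ∩ 𝓞_{K⁺}` non-split in `K`. -/
theorem two_dvd_card_stabilizer_iff (P : Ideal (𝓞 K)) [P.IsPrime] :
    2 ∣ Nat.card (MulAction.stabilizer (K ≃ₐ[ℚ] K) P) ↔
      ((P.under (𝓞 (maximalRealSubfield K))).primesOver (𝓞 K)).ncard = 1 := by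
  rw [← conjGal_mem_stabilizer_iff_two_dvd_card]
  exact conjGal_mem_stabilizer_iff K P

/-- **«c ∈ D_p iff Frob_p has even order»** read through `|D_P| = e·f`: for `P` above the rational prime
`p`, `2 ∣ e(P∣p)·f(P∣p) ⟺ P ∩ 𝓞_{K⁺}` is non-split in `K`. -/
theorem two_dvd_ramificationIdx_mul_inertiaDeg_iff {p : ℕ} (hp : p.Prime) (P : Ideal (𝓞 K))
    [P.IsPrime] [P.LiesOver (Ideal.span {(p : ℤ)})] :
    2 ∣ P.ramificationIdx ℤ * P.inertiaDeg ℤ ↔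
      ((P.under (𝓞 (maximalRealSubfield K))).primesOver (𝓞 K)).ncard = 1 := by
  rw [← T5DecompositionOrder.card_stabilizer_eq_ramificationIdx_mul_inertiaDeg hp P]
  exact two_dvd_card_stabilizer_iff K P

/-! ### v2 (append-only): the unramified dictionary and the sextic reading
For unramified `p`: `2 ∣ f(P∣p) ⟺ w non-split` (`two_dvd_inertiaDeg_iff_of_unramified`); on a sextic
`K` with quadratic subfield `K₂`: `w non-split ⟺ f(P ∩ 𝓞_{K₂} ∣ p) = 2`, i.e. «iff `p` does not split
in `K₂`» (`ncard_primesOver_eq_one_iff_inertiaDeg_quadratic`) — row N2.2.5's two ends. -/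

/-- `c ∈ D_P ⟺ 2 ∣ e(P∣p)·f(P∣p)` (file 66's `conj_mem_stabilizer_iff` for the complex conjugation). -/
theorem conjGal_mem_stabilizer_iff_two_dvd_mul {p : ℕ} (hp : p.Prime) (P : Ideal (𝓞 K)) [P.IsPrime]
    [P.LiesOver (Ideal.span {(p : ℤ)})] :
    conjGal K ∈ MulAction.stabilizer (K ≃ₐ[ℚ] K) P ↔ 2 ∣ P.ramificationIdx ℤ * P.inertiaDeg ℤ :=
  T5DecompositionOrder.conj_mem_stabilizer_iff (T5CMConjugation.orderOf_conjGal K) hp P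

/-- **Unramified `p`**: `c ∈ D_P ⟺ 2 ∣ f(P∣p)` — «`c ∈ D_p` iff `Frob_p` has even order» with
`D_P = ⟨Frob_P⟩` of order `f` (file 66's `conj_mem_stabilizer_iff_of_unramified`). -/
theorem conjGal_mem_stabilizer_iff_of_unramified {p : ℕ} (hp : p.Prime) (P : Ideal (𝓞 K)) [P.IsPrime]
    [P.LiesOver (Ideal.span {(p : ℤ)})] (he : P.ramificationIdx ℤ = 1) :
    conjGal K ∈ MulAction.stabilizer (K ≃ₐ[ℚ] K) P ↔ 2 ∣ P.inertiaDeg ℤ :=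
  T5DecompositionOrder.conj_mem_stabilizer_iff_of_unramified (T5CMConjugation.orderOf_conjGal K) hp P he

/-- **Row N2.2.5 for unramified `p` on a CM field**: `2 ∣ f(P∣p) ⟺ P ∩ 𝓞_{K⁺}` is non-split in `K`. -/
theorem two_dvd_inertiaDeg_iff_of_unramified {p : ℕ} (hp : p.Prime) (P : Ideal (𝓞 K)) [P.IsPrime]
    [P.LiesOver (Ideal.span {(p : ℤ)})] (he : P.ramificationIdx ℤ = 1) :
    2 ∣ P.inertiaDeg ℤ ↔ ((P.under (𝓞 (maximalRealSubfield K))).primesOver (𝓞 K)).ncard = 1 := by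
  rw [← conjGal_mem_stabilizer_iff_of_unramified K hp P he]
  exact conjGal_mem_stabilizer_iff K P

/-- **The sextic reading**: for `K` of degree `6` with `K₂ ⊆ K` the quadratic subfield (`[K : K₂] = 3`)
and `p` unramified, `c ∈ D_P ⟺ f(P ∩ 𝓞_{K₂} ∣ p) = 2` — «iff `p` does NOT split in `K₂`» (file 66's
`conj_mem_stabilizer_iff_inertiaDeg_quadratic` for the complex conjugation). -/
theorem conjGal_mem_stabilizer_iff_inertiaDeg_quadratic {p : ℕ} (hp : p.Prime) (P : Ideal (𝓞 K))
    [P.IsPrime] [P.LiesOver (Ideal.span {(p : ℤ)})] {K₂ : Type*} [Field K₂] [NumberField K₂]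
    [Algebra K₂ K] [IsGalois K₂ K] [IsGalois ℚ K₂] (h3 : Module.finrank K₂ K = 3)
    (h2 : Module.finrank ℚ K₂ = 2) (he : P.ramificationIdx ℤ = 1) :
    conjGal K ∈ MulAction.stabilizer (K ≃ₐ[ℚ] K) P ↔ (P.under (𝓞 K₂)).inertiaDeg ℤ = 2 :=
  T5DecompositionOrder.conj_mem_stabilizer_iff_inertiaDeg_quadratic
    (T5CMConjugation.orderOf_conjGal K) hp P h3 h2 he

/-- **Row N2.2.5's two ends on a CM sextic field**: `P ∩ 𝔬_{K⁺}` non-split in `K` ⟺ `p` does not split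
in the quadratic subfield `K₂` (`f(P ∩ 𝓞_{K₂} ∣ p) = 2`), for unramified `p`. -/
theorem ncard_primesOver_eq_one_iff_inertiaDeg_quadratic {p : ℕ} (hp : p.Prime) (P : Ideal (𝓞 K))
    [P.IsPrime] [P.LiesOver (Ideal.span {(p : ℤ)})] {K₂ : Type*} [Field K₂] [NumberField K₂]
    [Algebra K₂ K] [IsGalois K₂ K] [IsGalois ℚ K₂] (h3 : Module.finrank K₂ K = 3)
    (h2 : Module.finrank ℚ K₂ = 2) (he : P.ramificationIdx ℤ = 1) :
    ((P.under (𝓞 (maximalRealSubfield K))).primesOver (𝓞 K)).ncard = 1 ↔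
      (P.under (𝓞 K₂)).inertiaDeg ℤ = 2 := by
  rw [← conjGal_mem_stabilizer_iff K P]
  exact conjGal_mem_stabilizer_iff_inertiaDeg_quadratic K hp P h3 h2 he

/-! ### v3 (append-only): the row's literal wording — «c ∈ D_p iff Frob_p has even order»
with `Frob_P = arithFrobAt` (file 68's `frobD`, of order `f(P∣p)` for unramified `p`). -/

/-- **«c ∈ D_p iff Frob_p has even order»** for unramified `p`, with `c` the complex conjugation and
`Frob_P` Mathlib's arithmetic Frobenius (file 68: `orderOf frobD = f(P∣p)`). -/
theorem conjGal_mem_stabilizer_iff_two_dvd_orderOf_frobD {p : ℕ} (hp : p.Prime) (P : Ideal (𝓞 K))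
    [P.IsPrime] [P.LiesOver (Ideal.span {(p : ℤ)})] (he : P.ramificationIdx ℤ = 1) :
    conjGal K ∈ MulAction.stabilizer (K ≃ₐ[ℚ] K) P ↔
      2 ∣ orderOf (T5FrobeniusGenerates.frobD hp P) := by
  rw [T5FrobeniusGenerates.orderOf_frobD hp P he]
  exact conjGal_mem_stabilizer_iff_of_unramified K hp P he

/-- **«w non-split in E iff Frob_p has even order»** for unramified `p` on a CM field. -/
theorem ncard_primesOver_eq_one_iff_two_dvd_orderOf_frobD {p : ℕ} (hp : p.Prime) (P : Ideal (𝓞 K))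
    [P.IsPrime] [P.LiesOver (Ideal.span {(p : ℤ)})] (he : P.ramificationIdx ℤ = 1) :
    ((P.under (𝓞 (maximalRealSubfield K))).primesOver (𝓞 K)).ncard = 1 ↔
      2 ∣ orderOf (T5FrobeniusGenerates.frobD hp P) := by
  rw [← conjGal_mem_stabilizer_iff_two_dvd_orderOf_frobD K hp P he]
  exact (conjGal_mem_stabilizer_iff K P).symm

omit [IsCyclic (K ≃ₐ[ℚ] K)] in
/-- The complex conjugation is a power of the Frobenius exactly when `P ∩ 𝓞_{K⁺}` is non-split in `K`
(`D_P = ⟨Frob_P⟩`, file 68). -/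
theorem exists_frob_pow_eq_conjGal_iff {p : ℕ} (hp : p.Prime) (P : Ideal (𝓞 K)) [P.IsPrime]
    [P.LiesOver (Ideal.span {(p : ℤ)})] (he : P.ramificationIdx ℤ = 1) :
    (∃ n : ℤ, T5FrobeniusGenerates.frob hp P ^ n = conjGal K) ↔
      ((P.under (𝓞 (maximalRealSubfield K))).primesOver (𝓞 K)).ncard = 1 := by
  rw [← conjGal_mem_stabilizer_iff K P]
  refine ⟨fun ⟨n, hn⟩ => ?_, fun h => T5FrobeniusGenerates.exists_frob_zpow_eq hp P he _ h⟩
  rw [← hn]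
  exact Subgroup.zpow_mem _ (T5FrobeniusGenerates.frob_mem_stabilizer hp P) n

end Absolute

end Summit.Ventures.HodgeRepro2.T5CMDecomposition
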